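import Summits.QuantumFields.QCD.Theses.QuarksAsStableAction
import Literature.MathematicalPhysics.QuantumLattice.WilsonDiracAP

/-!
# S5 `stub_twoStaticGain`, auxiliary file — bookkeeping of the two-static gain (crux `stmt-QuantumFields-9734`, line `Sketch`)

Sub-problem context: `Summits/QuantumFields/QCD/Statement.lean`; crux decl
`Summit.QuantumFields.QCD.Theses.QuarksAsStableAction.CriticalLineDiamagnetism`.  Pure theorem file (worker wave 4 + lead c3):
the abstract assembly `TwoStaticGain.main` (split a product of per-frequency factors into heavy ones that gain and light ones that
do not), the exponent bookkeeping, `cos θ ≤ −199/200` for `|θ − π| ≤ 1/10`, and the counts of heavy antiperiodic frequencies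
(`≥ L/100` per axis for `L ≥ 200`).  Registered anchor: `cos_le_of_near_pi`.
-/

noncomputable section

open scoped BigOperators Classical Matrix ComplexConjugate
open Finset
open Literature.MathematicalPhysics.QuantumLattice Literature.MathematicalPhysics.QuantumFieldTheory

namespace Summit.QuantumFields.QCD.Cruxes.CriticalLineDiamagnetism.ChessboardCellGain

namespace TwoStaticGain

/-! ## Elementary bookkeeping -/

/-- Product bookkeeping: `0 ≤ f ≤ g` everywhere and `f ≤ exp E · g` on the set `{P}` give
`∏ f ≤ exp (#{P} · min 0 E) · ∏ g`. -/
theorem prod_le_exp_mul_prod {ι : Type*} [Fintype ι] (P : ι → Prop) [DecidablePred P]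
    (f g : ι → ℝ) (E : ℝ) (hf : ∀ k, 0 ≤ f k) (hfg : ∀ k, f k ≤ g k)
    (hP : ∀ k, P k → f k ≤ Real.exp E * g k) :
    ∏ k, f k ≤ Real.exp (((univ.filter P).card : ℝ) * min 0 E) * ∏ k, g k := by
  have key : ∀ k, f k ≤ (if P k then Real.exp (min 0 E) else 1) * g k := by
    intro k
    split_ifs with hk
    · rcases le_or_gt 0 E with hE | hE
      · rw [min_eq_left hE, Real.exp_zero, one_mul]
        exact hfg k
      · rw [min_eq_right hE.le]
        exact hP k hk
    · rw [one_mul]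
      exact hfg k
  calc ∏ k, f k ≤ ∏ k, (if P k then Real.exp (min 0 E) else 1) * g k :=
        Finset.prod_le_prod (fun k _ => hf k) fun k _ => key k
    _ = (∏ k, (if P k then Real.exp (min 0 E) else 1)) * ∏ k, g k := Finset.prod_mul_distrib
    _ = Real.exp (min 0 E) ^ (univ.filter P).card * ∏ k, g k := by
        rw [Finset.prod_ite, Finset.prod_const, Finset.prod_const_one, mul_one]
    _ = Real.exp (((univ.filter P).card : ℝ) * min 0 E) * ∏ k, g k := by
        rw [← Real.exp_nat_mul]

/-- Exponent bookkeeping: with `L²/10⁴ ≤ h ≤ L²`,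
`h · min 0 (1/L² − cS + CN) ≤ 1 − (c/10⁴) L² S + (max C 0) L² N`. -/
theorem exponent_le (Lsq h c C S N : ℝ) (hc : 0 ≤ c) (hN : 0 ≤ N) (hh : 0 ≤ h) (hhL : h ≤ Lsq)
    (hLh : Lsq / 10000 ≤ h) (hL : 0 < Lsq) :
    h * min 0 (1 / Lsq - c * S + C * N) ≤ 1 - c / 10000 * Lsq * S + max C 0 * Lsq * N := by
  have hC : C ≤ max C 0 := le_max_left _ _
  have hC0 : 0 ≤ max C 0 := le_max_right _ _
  have h3 : 0 ≤ max C 0 * Lsq * N := mul_nonneg (mul_nonneg hC0 hL.le) hN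
  rcases le_or_gt S 0 with hS | hS
  · have h1 : h * min 0 (1 / Lsq - c * S + C * N) ≤ 0 :=
      mul_nonpos_iff.2 (Or.inl ⟨hh, min_le_left _ _⟩)
    have h2 : c / 10000 * Lsq * S ≤ 0 :=
      mul_nonpos_iff.2 (Or.inl ⟨mul_nonneg (div_nonneg hc (by norm_num)) hL.le, hS⟩)
    linarith
  · have h1 : h * min 0 (1 / Lsq - c * S + C * N) ≤ h * (1 / Lsq - c * S + C * N) :=
      mul_le_mul_of_nonneg_left (min_le_right _ _) hh
    have h2 : h * (1 / Lsq) ≤ 1 := by rw [mul_one_div, div_le_one hL]; exact hhL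
    have h4 : c * S * (Lsq / 10000) ≤ c * S * h :=
      mul_le_mul_of_nonneg_left hLh (mul_nonneg hc hS.le)
    have h5 : C * (h * N) ≤ max C 0 * (h * N) := mul_le_mul_of_nonneg_right hC (mul_nonneg hh hN)
    have h6 : max C 0 * N * h ≤ max C 0 * N * Lsq := mul_le_mul_of_nonneg_left hhL (mul_nonneg hC0 hN)
    nlinarith

/-- If `|θ − π| ≤ 1/10` then `cos θ ≤ −199/200` (`cos (1/10) ≥ 1 − 1/200`). -/
theorem cos_le_of_near_pi : ∀ θ : ℝ, |θ - Real.pi| ≤ 1 / 10 → Real.cos θ ≤ -(199 / 200) := by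
  intro θ h
  have h1 : Real.cos θ = -Real.cos (θ - Real.pi) := by rw [Real.cos_sub_pi, neg_neg]
  have h2 : 1 - (θ - Real.pi) ^ 2 / 2 ≤ Real.cos (θ - Real.pi) := Real.one_sub_sq_div_two_le_cos
  have h3 : (θ - Real.pi) ^ 2 ≤ (1 / 10) ^ 2 := by
    rw [← sq_abs]
    exact pow_le_pow_left₀ (abs_nonneg _) h 2
  rw [h1]
  linarith

/-- One-dimensional count of heavy frequencies: for `L ≥ 200`, at least `L/100` of the `L` antiperiodic
frequencies `π(2k+1)/L` have cosine `≤ −199/200`. -/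
theorem card_heavy_one_dim (L : ℕ) (hL : 200 ≤ L) :
    (L : ℝ) / 100 ≤ ((univ.filter fun k : Fin L =>
      Real.cos (Real.pi * (2 * ((k : ℕ) : ℝ) + 1) / L) ≤ -(199 / 200)).card : ℝ) := by
  have hL0 : 0 < L := by omega
  have hLr : (0 : ℝ) < L := by exact_mod_cast hL0
  have hcount : 2 * (L / 100) + 1 ≤ (univ.filter fun k : Fin L =>
      Real.cos (Real.pi * (2 * ((k : ℕ) : ℝ) + 1) / L) ≤ -(199 / 200)).card := by
    refine Finset.le_card_of_inj_on_range
      (fun j => (⟨(L / 2 - L / 100 + j) % L, Nat.mod_lt _ hL0⟩ : Fin L)) ?_ ?_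
    · intro j hj
      have hlt : L / 2 - L / 100 + j < L := by omega
      rw [Finset.mem_filter]
      refine ⟨Finset.mem_univ _, ?_⟩
      simp only [Nat.mod_eq_of_lt hlt]
      apply cos_le_of_near_pi
      have hup' : (2 * ((L / 2 - L / 100 + j : ℕ) : ℝ) + 1) ≤ L + (2 * ((L / 100 : ℕ) : ℝ) + 1) := by
        exact_mod_cast (show 2 * (L / 2 - L / 100 + j) + 1 ≤ L + (2 * (L / 100) + 1) by omega)
      have hdn' : (L : ℝ) ≤ 2 * ((L / 2 - L / 100 + j : ℕ) : ℝ) + 1 + (2 * ((L / 100 : ℕ) : ℝ) + 1) := by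
        exact_mod_cast (show L ≤ 2 * (L / 2 - L / 100 + j) + 1 + (2 * (L / 100) + 1) by omega)
      have hwin' : (40 : ℝ) * (2 * ((L / 100 : ℕ) : ℝ) + 1) ≤ L := by
        exact_mod_cast (show 40 * (2 * (L / 100) + 1) ≤ L by omega)
      have hkey : Real.pi * (2 * ((L / 100 : ℕ) : ℝ) + 1) ≤ 1 / 10 * L := by
        nlinarith [Real.pi_le_four, Real.pi_pos]
      have heq : Real.pi * (2 * ((L / 2 - L / 100 + j : ℕ) : ℝ) + 1) / L - Real.pi =
          Real.pi * (2 * ((L / 2 - L / 100 + j : ℕ) : ℝ) + 1 - L) / L := by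
        field_simp
      rw [heq, abs_le]
      constructor
      · rw [le_div_iff₀ hLr]
        nlinarith [Real.pi_pos]
      · rw [div_le_iff₀ hLr]
        nlinarith [Real.pi_pos]
    · intro i hi j hj hij
      have := congrArg Fin.val hij
      simp only at this
      rwa [Nat.mod_eq_of_lt (by omega), Nat.mod_eq_of_lt (by omega), add_right_inj] at this
  have h100' : (L : ℝ) ≤ 100 * ((L / 100 : ℕ) : ℝ) + 99 := by
    exact_mod_cast (show L ≤ 100 * (L / 100) + 99 by omega)
  have hLr200 : (200 : ℝ) ≤ L := by exact_mod_cast hL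
  calc (L : ℝ) / 100 ≤ ((2 * (L / 100) + 1 : ℕ) : ℝ) := by push_cast; linarith
    _ ≤ _ := by exact_mod_cast hcount

/-- Two-dimensional count: for `L ≥ 200` at least `L²/10000` of the `L²` frequency pairs are heavy. -/
theorem card_heavy_two_dim (L : ℕ) (hL : 200 ≤ L) :
    (L : ℝ) ^ 2 / 10000 ≤ ((univ.filter fun k : Fin L × Fin L =>
      Real.cos (Real.pi * (2 * ((k.1 : ℕ) : ℝ) + 1) / L) ≤ -(199 / 200) ∧
      Real.cos (Real.pi * (2 * ((k.2 : ℕ) : ℝ) + 1) / L) ≤ -(199 / 200)).card : ℝ) := by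
  have h1 := card_heavy_one_dim L hL
  have hset : (univ.filter fun k : Fin L × Fin L =>
      Real.cos (Real.pi * (2 * ((k.1 : ℕ) : ℝ) + 1) / L) ≤ -(199 / 200) ∧
      Real.cos (Real.pi * (2 * ((k.2 : ℕ) : ℝ) + 1) / L) ≤ -(199 / 200)) =
      (univ.filter fun k : Fin L => Real.cos (Real.pi * (2 * ((k : ℕ) : ℝ) + 1) / L) ≤ -(199 / 200)) ×ˢ
      (univ.filter fun k : Fin L => Real.cos (Real.pi * (2 * ((k : ℕ) : ℝ) + 1) / L) ≤ -(199 / 200)) := by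
    ext k
    simp only [Finset.mem_filter, Finset.mem_univ, true_and, Finset.mem_product]
  rw [hset, Finset.card_product, Nat.cast_mul]
  have h0 : (0 : ℝ) ≤ L / 100 := by positivity
  nlinarith

/-! ## The assembly, abstractly -/

/-- The doubly static gain from the three frequency stubs, for ABSTRACT families: `W L A m` (the Wilson determinant of
the lift of `A`), `WT L m` (that of the all-seams field, `= W L 1 m` by `hT`), `F L A m ω₀ ω₁` (the 2D frequency
determinant) and `D L A a b` (the plaquette deficit).  Constants: `ε = 1/10`, `c' = c/10⁴`, `K = 1`, `C' = max C 0`,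
`L₀' = max L₀ 200`. -/
theorem main
    (W : ∀ (L : ℕ) [NeZero L], (ZMod L → ZMod L → Fin 4 → Matrix.unitaryGroup (Fin 3) ℂ) → ℝ → ℂ)
    (WT : ∀ (L : ℕ) [NeZero L], ℝ → ℂ)
    (F : ∀ (L : ℕ) [NeZero L], (ZMod L → ZMod L → Fin 4 → Matrix.unitaryGroup (Fin 3) ℂ) → ℝ → ℝ → ℝ → ℂ)
    (D : ∀ (L : ℕ), (ZMod L → ZMod L → Fin 4 → Matrix.unitaryGroup (Fin 3) ℂ) → ZMod L → ZMod L → ℝ)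
    (hT : ∀ (L : ℕ) [NeZero L] (m : ℝ), WT L m = W L (fun _ _ _ => 1) m)
    (hF : ∀ (L : ℕ) [NeZero L] (A : ZMod L → ZMod L → Fin 4 → Matrix.unitaryGroup (Fin 3) ℂ) (m : ℝ),
      W L A m = ∏ k₀ : Fin L, ∏ k₁ : Fin L,
        F L A m (Real.pi * (2 * (k₀ : ℕ) + 1) / L) (Real.pi * (2 * (k₁ : ℕ) + 1) / L))
    (hD : ∀ (L : ℕ) [NeZero L], Odd L → ∀ (A : ZMod L → ZMod L → Fin 4 → Matrix.unitaryGroup (Fin 3) ℂ) (m : ℝ), -1 < m →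
      ∀ ω₀ ω₁ : ℝ, ‖F L A m ω₀ ω₁‖ ≤ ‖F L (fun _ _ _ => 1) m ω₀ ω₁‖)
    (hG : ∃ δ c C : ℝ, 0 < δ ∧ 0 < c ∧ ∃ L₀ : ℕ, ∀ (L : ℕ) [NeZero L], Odd L → L₀ ≤ L →
      ∀ (A : ZMod L → ZMod L → Fin 4 → Matrix.unitaryGroup (Fin 3) ℂ) (m : ℝ), |m| ≤ 1 / 10 → ∀ ω₀ ω₁ : ℝ,
      Real.cos ω₀ ≤ -(199 / 200) → Real.cos ω₁ ≤ -(199 / 200) →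
      ‖F L A m ω₀ ω₁‖ ≤
        Real.exp (1 / (L : ℝ) ^ 2
          - c * (∑ ab ∈ (Finset.univ : Finset (ZMod L × ZMod L)).filter (fun ab => D L A ab.1 ab.2 < δ),
              D L A ab.1 ab.2)
          + C * (((Finset.univ : Finset (ZMod L × ZMod L)).filter (fun ab => δ ≤ D L A ab.1 ab.2)).card : ℝ)) *
        ‖F L (fun _ _ _ => 1) m ω₀ ω₁‖) :
    ∃ ε δ c K C : ℝ, 0 < ε ∧ 0 < δ ∧ 0 < c ∧ ∃ L₀ : ℕ, ∀ (L : ℕ) [NeZero L], Odd L → L₀ ≤ L →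
      ∀ (A : ZMod L → ZMod L → Fin 4 → Matrix.unitaryGroup (Fin 3) ℂ) (m : ℝ), |m| ≤ ε →
      ‖W L A m‖ ≤
        Real.exp (K
          - c * (L : ℝ) ^ 2 * (∑ ab ∈ (Finset.univ : Finset (ZMod L × ZMod L)).filter (fun ab => D L A ab.1 ab.2 < δ),
              D L A ab.1 ab.2)
          + C * (L : ℝ) ^ 2 * (((Finset.univ : Finset (ZMod L × ZMod L)).filter (fun ab => δ ≤ D L A ab.1 ab.2)).card : ℝ)) *
        ‖WT L m‖ := by
  obtain ⟨δ, c, C, hδ, hc, L₀, hG⟩ := hG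
  refine ⟨1 / 10, δ, c / 10000, 1, max C 0, by norm_num, hδ, by positivity, max L₀ 200, ?_⟩
  intro L _ hodd hL A m hm
  have hL₀ : L₀ ≤ L := le_of_max_le_left hL
  have h200 : 200 ≤ L := le_of_max_le_right hL
  have hm1 : -1 < m := by have := (abs_le.1 hm).1; linarith
  set θ : Fin L → ℝ := fun k => Real.pi * (2 * (k : ℕ) + 1) / L with hθ
  set f : Fin L × Fin L → ℝ := fun k => ‖F L A m (θ k.1) (θ k.2)‖ with hf
  set g : Fin L × Fin L → ℝ := fun k => ‖F L (fun _ _ _ => 1) m (θ k.1) (θ k.2)‖ with hg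
  set S : ℝ := ∑ ab ∈ (Finset.univ : Finset (ZMod L × ZMod L)).filter (fun ab => D L A ab.1 ab.2 < δ),
    D L A ab.1 ab.2 with hS
  set N : ℝ := (((Finset.univ : Finset (ZMod L × ZMod L)).filter (fun ab => δ ≤ D L A ab.1 ab.2)).card : ℝ)
    with hN
  have hlhs : ‖W L A m‖ = ∏ k, f k := by
    rw [hF L A m, norm_prod, Fintype.prod_prod_type]
    simp only [norm_prod, hf, hθ]
  have hrhs : ‖WT L m‖ = ∏ k, g k := by
    rw [hT L m, hF L _ m, norm_prod, Fintype.prod_prod_type]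
    simp only [norm_prod, hg, hθ]
  have hprod := prod_le_exp_mul_prod
    (fun k : Fin L × Fin L => Real.cos (θ k.1) ≤ -(199 / 200) ∧ Real.cos (θ k.2) ≤ -(199 / 200)) f g
    (1 / (L : ℝ) ^ 2 - c * S + C * N) (fun k => norm_nonneg _)
    (fun k => hD L hodd A m hm1 (θ k.1) (θ k.2))
    (fun k hk => hG L hodd hL₀ A m hm (θ k.1) (θ k.2) hk.1 hk.2)
  have hcard_le : (((Finset.univ : Finset (Fin L × Fin L)).filter
      (fun k : Fin L × Fin L => Real.cos (θ k.1) ≤ -(199 / 200) ∧ Real.cos (θ k.2) ≤ -(199 / 200))).card : ℝ)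
      ≤ (L : ℝ) ^ 2 := by
    have h := Finset.card_filter_le (Finset.univ : Finset (Fin L × Fin L))
      (fun k : Fin L × Fin L => Real.cos (θ k.1) ≤ -(199 / 200) ∧ Real.cos (θ k.2) ≤ -(199 / 200))
    rw [Finset.card_univ, Fintype.card_prod, Fintype.card_fin] at h
    have h' : (((Finset.univ : Finset (Fin L × Fin L)).filter
      (fun k : Fin L × Fin L => Real.cos (θ k.1) ≤ -(199 / 200) ∧ Real.cos (θ k.2) ≤ -(199 / 200))).card : ℝ)
      ≤ ((L * L : ℕ) : ℝ) := by exact_mod_cast h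
    simpa [sq] using h'
  have hcard_ge : (L : ℝ) ^ 2 / 10000 ≤ (((Finset.univ : Finset (Fin L × Fin L)).filter
      (fun k : Fin L × Fin L => Real.cos (θ k.1) ≤ -(199 / 200) ∧ Real.cos (θ k.2) ≤ -(199 / 200))).card : ℝ) :=
    card_heavy_two_dim L h200
  have hexp := exponent_le ((L : ℝ) ^ 2) _ c C S N hc.le (by positivity) (by positivity) hcard_le hcard_ge
    (by positivity)
  calc ‖W L A m‖ = ∏ k, f k := hlhs
    _ ≤ _ := hprod
    _ ≤ Real.exp (1 - c / 10000 * (L : ℝ) ^ 2 * S + max C 0 * (L : ℝ) ^ 2 * N) * ∏ k, g k :=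
        mul_le_mul_of_nonneg_right (Real.exp_le_exp.2 hexp) (Finset.prod_nonneg fun k _ => norm_nonneg _)
    _ = _ := by rw [hrhs]

end TwoStaticGain

end Summit.QuantumFields.QCD.Cruxes.CriticalLineDiamagnetism.ChessboardCellGain
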